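import Literature.Barriers.CriticalPhenomena.LaceExpansionXSpaceWeightedPieces
import HarnessLib

/-!
# The `H^{(β)}`-piece of Hara's weighted `N`-loop bound: `‖B₁ B̃₂⁽²⁾ B₁‖_mix ≤ |0|^c p_c² (2d)² H̄^{(β)}`
# (Hara 2008, §3.4, case (b-7)) — PROVED

Barrier catalogue `Literature/Barriers/CriticalPhenomena/` (D-0021). Fifth layer under
`Hara2008_weightedNLoopBoundPc` (`LaceExpansionXSpaceLemma16.lean`), completing the piece estimates of
`LaceExpansionXSpaceWeightedPieces.lean` by the one two-loop piece: when the weight `|·|^β` sits on the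
path line `τ(u' - z)` of the second term `B₂⁽²⁾` of `B₂` (Heydenreich–van der Hofstad (7.4.4)), the
middle factor of the three-factor estimate must be `B₁ B̃₂⁽²⁾ B₁` (as in (7.5.26)–(7.5.27), whose
`k`-space analogue is `H_p(a₁,a₂;k)` of (7.5.1)), and its mixed norm is Hara's `H^{(β)}(a,b)` (§1.1) with
the two outer plain lines replaced by pivotal lines `τ̃ = p_c Σ_{|e|=1} τ(· - e)`: "The case (b-7) is
more complicated. Decomposing as before, we encounter the leftmost component of Figure (f). … This is
nothing but `H^{(β)}(a, b)` … and is finite by the assumption of the lemma." PROVED here: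

* `hSharp d F F' b s a₁ a₂` — the two-loop sum with general outer lines `F, F'`; `tsum_kB1_kB2twoW_kB1_eq`
  (the row sums of `B₁ B̃₂⁽²⁾^{(b,c)} B₁` are `|0|^c hSharp(τ̃, τ̃)`), linearity in the outer lines
  (`hSharp_finset_sum_left/right`, `hSharp_const_mul_left/right`, `hSharp_unitSum_unitSum`);
* `hSharp_tau_tau_le` — THE IDENTIFICATION: with plain shifted lines `τ(· - e)`, `τ(· - e')`, `hSharp` is
  a reindexing (an explicit bijection of `(ℤ^d)⁵`, translating by the vertex `z`) of Hara's
  `H^{(b)}(a₁ + e, e' - a₂)` as vendored in `haraHBar` (`LaceExpansionXSpaceNorms.lean`), hence `≤ H̄^{(b)}`;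
* `pkNormMix_kB1_kB2twoW_kB1_le : ‖B₁ B̃₂⁽²⁾^{(b,c)} B₁‖_mix ≤ |0|^c · p_c² (2d)² · H̄^{(b)}`.

## References

* T. Hara, Ann. Probab. 36 (2008) 530–593 (arXiv:math-ph/0504021): §1.1 (`H^{(β)}(a,b)`), §3.4 (Step 2,
  case (b-7); the pivotal line `2dp(D⋆G)`).
* M. Heydenreich, R. van der Hofstad, *Progress in High-Dimensional Percolation and Random Graphs*,
  Springer 2017: (7.2.3), (7.4.4), (7.5.1)–(7.5.2), (7.5.26)–(7.5.27).
-/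

noncomputable section

namespace Literature.Barriers.CriticalPhenomena

open _root_.MeasureTheory _root_.Filter Literature.Probability.LatticeModels
  Literature.Probability.Percolation

open scoped ENNReal

/-! ### The `H^{(β)}`-piece: `B₁ B̃₂⁽²⁾ B₁` in the mixed norm (Hara's case (b-7)) -/

section HPiece

variable {d : ℕ}

/-- The sum over the `2d` unit vectors `±e_i`. [folklore] -/
def unitSum (F : Site d → ℝ≥0∞) : ℝ≥0∞ := ∑ i : Fin d, (F (Pi.single i 1) + F (-Pi.single i 1))

/-- `τ̃(y) = p_c Σ_{|e|=1} τ(y - e)`. [cite: HeydenreichVanDerHofstad2017, (7.2.3)] -/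
theorem tauTildePcE_eq_unitSum (y : Site d) :
    tauTildePcE d y = ENNReal.ofReal (criticalProbI d) * unitSum (fun e => tauPcE d (y - e)) := by
  rw [tauTildePcE_eq, unitSum]
  congr 1
  refine Finset.sum_congr rfl fun i _ => ?_
  rw [sub_neg_eq_add]

/-- The two-loop sum behind `B₁ B̃₂⁽²⁾ B₁` with general outer lines `F, F'` in place of the two pivotal
lines: `Σ_{v,z,t,u,a} F(t - s - a₁) τ(z - s) [τ(a-t) τ(z-a) τ(u-a) G^{(b)}(u-z)] F'(v + a₂ - u) τ(v - t)`
(indexed by `(v, z, t, u, a) ∈ (ℤ^d)⁵`). [cite: HeydenreichVanDerHofstad2017, (7.5.1)] -/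
def hSharp (d : ℕ) (F F' : Site d → ℝ≥0∞) (b : ℝ) (s a₁ a₂ : Site d) : ℝ≥0∞ :=
  ∑' r : Site d × Site d × Site d × Site d × Site d,
    F (r.2.2.1 - s - a₁) * tauPcE d (r.2.1 - s) *
      (tauPcE d (r.2.2.2.2 - r.2.2.1) * tauPcE d (r.2.1 - r.2.2.2.2) * tauPcE d (r.2.2.2.1 - r.2.2.2.2) *
        gE d b (r.2.2.2.1 - r.2.1)) *
      (F' (r.1 + a₂ - r.2.2.2.1) * tauPcE d (r.1 - r.2.2.1))

/-- **The row sums of `B₁ B̃₂⁽²⁾^{(b,c)} B₁` are `|0|^c hSharp(τ̃, τ̃)`** (the Kronecker delta of `B₂⁽²⁾`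
identifies `w'` with `t`). [cite: HeydenreichVanDerHofstad2017, (7.5.1) and (7.5.26)–(7.5.27)] -/
theorem tsum_kB1_kB2twoW_kB1_eq (b c : ℝ) (s a₁ a₂ : Site d) :
    ∑' v : Site d, pkMul (kB1 d) (pkMul (kB2twoW d b c) (kB1 d)) (s, s + a₁) (v, v + a₂) =
      wE c (0 : Site d) * hSharp d (tauTildePcE d) (tauTildePcE d) b s a₁ a₂ := by
  -- Step 1: for fixed `v`, `(z,t)`: the sum over `(w', u')` collapses `w' = t`
  have hinner : ∀ (v : Site d) (zt : Site d × Site d),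
      pkMul (kB2twoW d b c) (kB1 d) zt (v, v + a₂) = wE c (0 : Site d) * ∑' u' : Site d, ∑' a : Site d,
        (tauPcE d (a - zt.2) * tauPcE d (zt.1 - a) * tauPcE d (u' - a) * gE d b (u' - zt.1)) *
          (tauTildePcE d (v + a₂ - u') * tauPcE d (v - zt.2)) := by
    intro v zt
    calc pkMul (kB2twoW d b c) (kB1 d) zt (v, v + a₂)
        = ∑' w' : Site d, ∑' u' : Site d, kB2twoW d b c zt (w', u') * kB1 d (w', u') (v, v + a₂) :=
          ENNReal.tsum_prod'
      _ = ∑' u' : Site d, kB2twoW d b c zt (zt.2, u') * kB1 d (zt.2, u') (v, v + a₂) := by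
          rw [tsum_eq_single zt.2]
          intro w' hw'
          simp [kB2twoW, Ne.symm hw']
      _ = _ := by
          rw [← ENNReal.tsum_mul_left]
          refine tsum_congr fun u' => ?_
          simp only [kB2twoW, if_true, kB1, percB1_eq]
          rw [mul_assoc (wE c 0), ← ENNReal.tsum_mul_right, ← ENNReal.tsum_mul_left]
  -- Step 2: assemble the five-fold sum
  calc ∑' v : Site d, pkMul (kB1 d) (pkMul (kB2twoW d b c) (kB1 d)) (s, s + a₁) (v, v + a₂)
      = ∑' v : Site d, ∑' zt : Site d × Site d, kB1 d (s, s + a₁) zt * (wE c (0 : Site d) *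
          ∑' u' : Site d, ∑' a : Site d,
            (tauPcE d (a - zt.2) * tauPcE d (zt.1 - a) * tauPcE d (u' - a) * gE d b (u' - zt.1)) *
              (tauTildePcE d (v + a₂ - u') * tauPcE d (v - zt.2))) := by
        refine tsum_congr fun v => tsum_congr fun zt => ?_
        rw [hinner]
    _ = wE c (0 : Site d) * ∑' v : Site d, ∑' zt : Site d × Site d, ∑' u' : Site d, ∑' a : Site d,
          kB1 d (s, s + a₁) zt *
            ((tauPcE d (a - zt.2) * tauPcE d (zt.1 - a) * tauPcE d (u' - a) * gE d b (u' - zt.1)) *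
              (tauTildePcE d (v + a₂ - u') * tauPcE d (v - zt.2))) := by
        rw [← ENNReal.tsum_mul_left]
        refine tsum_congr fun v => ?_
        rw [← ENNReal.tsum_mul_left]
        refine tsum_congr fun zt => ?_
        rw [mul_left_comm, ← ENNReal.tsum_mul_left]
        refine congrArg _ (tsum_congr fun u' => ?_)
        rw [← ENNReal.tsum_mul_left]
    _ = wE c (0 : Site d) * hSharp d (tauTildePcE d) (tauTildePcE d) b s a₁ a₂ := by
        congr 1
        rw [hSharp, ENNReal.tsum_prod']
        refine tsum_congr fun v => ?_
        rw [ENNReal.tsum_prod', ENNReal.tsum_prod']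
        refine tsum_congr fun z => ?_
        rw [ENNReal.tsum_prod']
        refine tsum_congr fun t => ?_
        rw [ENNReal.tsum_prod']
        refine tsum_congr fun u' => tsum_congr fun a => ?_
        simp only [kB1, percB1_eq]
        rw [show s + a₁ = a₁ + s by abel, ← sub_sub, show t - a₁ - s = t - s - a₁ by abel]
        ring

/-- `hSharp` is additive in the first outer line. [folklore] -/
theorem hSharp_finset_sum_left {ι : Type*} (S : Finset ι) (F : ι → Site d → ℝ≥0∞) (F' : Site d → ℝ≥0∞)
    (b : ℝ) (s a₁ a₂ : Site d) :
    hSharp d (fun y => ∑ i ∈ S, F i y) F' b s a₁ a₂ = ∑ i ∈ S, hSharp d (F i) F' b s a₁ a₂ := by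
  simp only [hSharp, Finset.sum_mul]
  exact Summable.tsum_finsetSum fun _ _ => ENNReal.summable

/-- `hSharp` is additive in the second outer line. [folklore] -/
theorem hSharp_finset_sum_right {ι : Type*} (S : Finset ι) (F : Site d → ℝ≥0∞) (F' : ι → Site d → ℝ≥0∞)
    (b : ℝ) (s a₁ a₂ : Site d) :
    hSharp d F (fun y => ∑ i ∈ S, F' i y) b s a₁ a₂ = ∑ i ∈ S, hSharp d F (F' i) b s a₁ a₂ := by
  simp only [hSharp, Finset.sum_mul, Finset.mul_sum]
  exact Summable.tsum_finsetSum fun _ _ => ENNReal.summable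

/-- Constants come out of `hSharp` (first line). [folklore] -/
theorem hSharp_const_mul_left (k : ℝ≥0∞) (F F' : Site d → ℝ≥0∞) (b : ℝ) (s a₁ a₂ : Site d) :
    hSharp d (fun y => k * F y) F' b s a₁ a₂ = k * hSharp d F F' b s a₁ a₂ := by
  simp only [hSharp, ← ENNReal.tsum_mul_left]
  exact tsum_congr fun r => by ring

/-- Constants come out of `hSharp` (second line). [folklore] -/
theorem hSharp_const_mul_right (k : ℝ≥0∞) (F F' : Site d → ℝ≥0∞) (b : ℝ) (s a₁ a₂ : Site d) :
    hSharp d F (fun y => k * F' y) b s a₁ a₂ = k * hSharp d F F' b s a₁ a₂ := by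
  simp only [hSharp, ← ENNReal.tsum_mul_left]
  exact tsum_congr fun r => by ring

/-- `hSharp` with two `unitSum`s of first/second lines. [folklore] -/
theorem hSharp_unitSum_unitSum (F F' : Site d → Site d → ℝ≥0∞) (b : ℝ) (s a₁ a₂ : Site d) :
    hSharp d (fun y => unitSum (fun e => F e y)) (fun y => unitSum (fun e => F' e y)) b s a₁ a₂ =
      unitSum (fun e => unitSum (fun e' => hSharp d (F e) (F' e') b s a₁ a₂)) := by
  simp only [unitSum]
  rw [show (fun y => ∑ i : Fin d, (F (Pi.single i 1) y + F (-Pi.single i 1) y)) =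
      fun y => ∑ i : Fin d, (fun i y => F (Pi.single i 1) y + F (-Pi.single i 1) y) i y from rfl,
    hSharp_finset_sum_left]
  refine Finset.sum_congr rfl fun i _ => ?_
  have hadd : ∀ (G G' : Site d → ℝ≥0∞) (H : Site d → ℝ≥0∞),
      hSharp d (fun y => G y + G' y) H b s a₁ a₂ = hSharp d G H b s a₁ a₂ + hSharp d G' H b s a₁ a₂ := by
    intro G G' H
    simp only [hSharp, add_mul, ENNReal.tsum_add]
  have hadd' : ∀ (G : Site d → ℝ≥0∞) (H H' : Site d → ℝ≥0∞),
      hSharp d G (fun y => H y + H' y) b s a₁ a₂ = hSharp d G H b s a₁ a₂ + hSharp d G H' b s a₁ a₂ := by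
    intro G H H'
    simp only [hSharp, add_mul, mul_add, ENNReal.tsum_add]
  have hsum : ∀ G : Site d → ℝ≥0∞,
      hSharp d G (fun y => ∑ i : Fin d, (F' (Pi.single i 1) y + F' (-Pi.single i 1) y)) b s a₁ a₂ =
        ∑ i : Fin d, (hSharp d G (F' (Pi.single i 1)) b s a₁ a₂ + hSharp d G (F' (-Pi.single i 1)) b s a₁ a₂) := by
    intro G
    rw [show (fun y => ∑ i : Fin d, (F' (Pi.single i 1) y + F' (-Pi.single i 1) y)) =
        fun y => ∑ i : Fin d, (fun i y => F' (Pi.single i 1) y + F' (-Pi.single i 1) y) i y from rfl,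
      hSharp_finset_sum_right]
    exact Finset.sum_congr rfl fun i _ => hadd' G _ _
  show hSharp d (fun y => F (Pi.single i 1) y + F (-Pi.single i 1) y) _ b s a₁ a₂ = _
  rw [hadd, hsum, hsum]

/-- **The reindexing onto Hara's `H^{(b)}`**: with plain lines `τ(· - e)`, `τ(· - e')` in place of the two
pivotal lines, `hSharp` is Hara's `H^{(b)}(a₁ + e, e' - a₂)` (vertex map: Hara's `0, x, u, v, z, y` are our
`z, u, a, t, s, v + a₂ - e'`, after translating by `-z`), hence at most `H̄^{(b)}`.
[cite: Hara2008, §1.1 (H^{(β)}(a,b)) and §3.4 (case (b-7): "This is nothing but H^{(β)}(a,b)")] -/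
theorem hSharp_tau_tau_le (b : ℝ) (s a₁ a₂ e e' : Site d) :
    hSharp d (fun y => tauPcE d (y - e)) (fun y => tauPcE d (y - e')) b s a₁ a₂ ≤ haraHBar d b := by
  -- Hara's `H^{(b)}(A, B)` with `A = a₁ + e`, `B = e' - a₂`, in `tauPcE`/`gE` form
  set A : Site d := a₁ + e with hA
  set B : Site d := e' - a₂ with hB
  have hH : (∑' r : Site d × Site d × Site d × Site d × Site d,
      tauPcE d r.2.2.1 * tauPcE d r.2.2.2.1 * tauPcE d (r.1 - r.2.2.2.1) * gE d b r.1 *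
        tauPcE d (r.2.1 - r.1) * tauPcE d (r.2.2.2.2 - r.2.2.2.1) * tauPcE d (r.2.2.1 + A - r.2.2.2.2) *
        tauPcE d (r.2.1 + B - r.2.2.2.2)) ≤ haraHBar d b := by
    refine le_trans (le_of_eq (tsum_congr fun r => ?_))
      (le_iSup (fun ab : Site d × Site d => ∑' r : Site d × Site d × Site d × Site d × Site d,
        ENNReal.ofReal (tau d (criticalProbI d) 0 r.2.2.1 * tau d (criticalProbI d) 0 r.2.2.2.1 *
          tau d (criticalProbI d) 0 (r.1 - r.2.2.2.1) * haraG d b r.1 *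
          tau d (criticalProbI d) 0 (r.2.1 - r.1) * tau d (criticalProbI d) 0 (r.2.2.2.2 - r.2.2.2.1) *
          tau d (criticalProbI d) 0 (r.2.2.1 + ab.1 - r.2.2.2.2) *
          tau d (criticalProbI d) 0 (r.2.1 + ab.2 - r.2.2.2.2))) (A, B))
    rw [ENNReal.ofReal_mul' (tau_nonneg _ _ _), ENNReal.ofReal_mul' (tau_nonneg _ _ _),
      ENNReal.ofReal_mul' (tau_nonneg _ _ _), ENNReal.ofReal_mul' (tau_nonneg _ _ _),
      ENNReal.ofReal_mul' (haraG_nonneg _ _ _), ENNReal.ofReal_mul' (tau_nonneg _ _ _),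
      ENNReal.ofReal_mul' (tau_nonneg _ _ _)]
    rfl
  refine le_trans (le_of_eq ?_) hH
  -- the bijection `(v, z, t, u, a) ↦ (x, y, zH, uH, vH) = (u - z, v + a₂ - e' - z, s - z, a - z, t - z)`
  let φ : Site d × Site d × Site d × Site d × Site d ≃ Site d × Site d × Site d × Site d × Site d :=
    { toFun := fun r => (r.2.2.2.1 - r.2.1, r.1 + a₂ - e' - r.2.1, s - r.2.1, r.2.2.2.2 - r.2.1, r.2.2.1 - r.2.1)
      invFun := fun q => (q.2.1 - a₂ + e' + (s - q.2.2.1), s - q.2.2.1, q.2.2.2.2 + (s - q.2.2.1),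
        q.1 + (s - q.2.2.1), q.2.2.2.1 + (s - q.2.2.1))
      left_inv := fun r => by
        obtain ⟨v, z, t, u, a⟩ := r
        simp only [Prod.mk.injEq]
        refine ⟨by abel, by abel, by abel, by abel, by abel⟩
      right_inv := fun q => by
        obtain ⟨x, y, zH, uH, vH⟩ := q
        simp only [Prod.mk.injEq]
        refine ⟨by abel, by abel, by abel, by abel, by abel⟩ }
  rw [hSharp, ← φ.symm.tsum_eq]
  · refine tsum_congr fun q => ?_
    obtain ⟨x, y, zH, uH, vH⟩ := q
    simp only [φ, Equiv.coe_fn_symm_mk]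
    -- match the eight lines
    rw [show vH + (s - zH) - s - a₁ - e = -(zH + A - vH) by rw [hA]; abel, tauPcE_neg,
      show s - zH - s = -zH by abel, tauPcE_neg,
      show uH + (s - zH) - (vH + (s - zH)) = -(vH - uH) by abel, tauPcE_neg,
      show s - zH - (uH + (s - zH)) = -uH by abel, tauPcE_neg,
      show x + (s - zH) - (uH + (s - zH)) = x - uH by abel,
      show x + (s - zH) - (s - zH) = x by abel,
      show y - a₂ + e' + (s - zH) + a₂ - (x + (s - zH)) - e' = y - x by abel,
      show y - a₂ + e' + (s - zH) - (vH + (s - zH)) = y + B - vH by rw [hB]; abel]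
    ring

/-- **The `H^{(β)}`-piece** (Hara's case (b-7): the weight `|·|^b` on the path line of `B₂⁽²⁾`, its
neighbours `B₁` on both sides; the two pivotal lines each averaged over the `2d` unit vectors):
`‖B₁ B̃₂⁽²⁾^{(b,c)} B₁‖_mix ≤ |0|^c · p_c² (2d)² · H̄^{(b)}`.
[cite: Hara2008, §3.4 (Step 2, case (b-7): "we encounter the leftmost component of Figure (f) … This is nothing but H^{(β)}(a,b)")]
[cite: HeydenreichVanDerHofstad2017, (7.5.1)–(7.5.2) and (7.5.26)–(7.5.27)] -/
theorem pkNormMix_kB1_kB2twoW_kB1_le (b c : ℝ) :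
    pkNormMix (pkMul (kB1 d) (pkMul (kB2twoW d b c) (kB1 d))) ≤
      wE c (0 : Site d) * (ENNReal.ofReal (criticalProbI d) ^ 2 * ((2 * d) ^ 2 * haraHBar d b)) := by
  refine iSup_le fun q => ?_
  obtain ⟨s, a₁, a₂⟩ := q
  dsimp only
  rw [tsum_kB1_kB2twoW_kB1_eq]
  refine mul_le_mul' le_rfl ?_
  -- expand the two pivotal lines
  rw [show tauTildePcE d = fun y => ENNReal.ofReal (criticalProbI d) * unitSum (fun e => tauPcE d (y - e))
      from funext tauTildePcE_eq_unitSum, hSharp_const_mul_left, hSharp_const_mul_right,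
    ← mul_assoc, ← pow_two]
  refine mul_le_mul' le_rfl ?_
  rw [hSharp_unitSum_unitSum (fun e y => tauPcE d (y - e)) (fun e y => tauPcE d (y - e))]
  -- each of the `(2d)²` terms is at most `H̄^{(b)}`
  calc unitSum (fun e => unitSum (fun e' => hSharp d (fun y => tauPcE d (y - e)) (fun y => tauPcE d (y - e')) b s a₁ a₂))
      ≤ unitSum (fun _ => unitSum (fun _ => haraHBar d b)) := by
        refine Finset.sum_le_sum fun i _ => add_le_add ?_ ?_ <;>
          refine Finset.sum_le_sum fun i' _ => add_le_add ?_ ?_ <;>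
          exact hSharp_tau_tau_le b s a₁ a₂ _ _
    _ = (2 * d) ^ 2 * haraHBar d b := by
        simp only [unitSum, Finset.sum_const, Finset.card_univ, Fintype.card_fin, nsmul_eq_mul, ← two_mul]
        ring

end HPiece

end Literature.Barriers.CriticalPhenomena
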